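import Summits.BirchSwinnertonDyer.BirchSwinnertonDyer.Theorems.ByReductionTypeAtTwoSupersingularFlatLevelDescent
import Summits.BirchSwinnertonDyer.BirchSwinnertonDyer.Theorems.ThetaPartnerAtTwoSignedKatoUpToAtTwoKatoBKTransport
import Literature.NumberTheory.EllipticCurves.CongrModOmegaOfValuesProofs
import HarnessLib

/-!
# Crux `SupersingularRankZeroAtTwo` (K4, item stmt-BirchSwinnertonDyer-19097), line `odd_blind_package` v2.19, `stub_flatPackage`
# conjunct (8), F3 (the ♭ explicit reciprocity computation at `2`) — FILE E3: the ALL-LEVELS VALUE IDENTITY and the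
# `Λ`-MULTIPLIER CONGRUENCE «`ν · P_{n,d_n}(w) ≡ μ · θ_n (mod ω_n)`» over DISPLAYED per-character inputs

Seat `bsd-2adic-tower-1` GEN 69, hand «hF3-ERL» (pen GEN 41 SUMMON 20260831T215831Z, director-bsd (979) slot 2). HONEST FRAMING:
theorems only (no definition, no named fact, no instance, no `sorry`); every published/kernel input is a DISPLAYED hypothesis; helper
toward conjunct (8) F3 of `stub_flatPackage`; closes no stub and no item; 19097 OPEN; BSD₂ is proved for no supersingular curve and BSD
for no curve by any of this.

## What (the shapes t42's Z2/Z4 consume; `Λ = ℤ₂⟦T⟧`, `x(z) := ∑ ι(x_k) zᵏ` for `x ∈ Λ`, `θ_n = mazurTateElement f 2 n`,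
## `P_{n,d}(w) = Sprung2012.pairingSum W A g n d w = ∑_{j<2ⁿ} w(gʲ d)(1+T)ʲ`)

For a rational newform `f` of odd level with `a₂(f) = a` (`hap : cuspCoeff f 2 = (a : ℂ)`), a `ℤ₂`-extension `κ` of a field `K`, an
embedding `ι`, a local Galois element `g` over the topological generator, Honda-type points `d_n ∈ E(K_n·E)` with the `a`-trace relation
`Tr_{n+2/n+1} d_{n+2} = a•d_{n+1} − d_n` (all `n`), a subgroup `A ∋ gʲ d_n` and a functional `w : A →+ ℤ₂`, and `μ ν ∈ Λ`:

* `forall_char_of_evalOn_of_primitive_or_le_one` — if «`ν(χ(5)−1)·∑_{j<2ⁿ} w(gʲ d_n) χ(5)ʲ = μ(χ(5)−1)·ratTwistedSymbolSum f χ`» holds for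
  the even `2`-power-order characters that are PRIMITIVE or have `n ≤ 1`, it holds for ALL of them (FILE E2b's induction with the P-side
  recursion supplied by `SSFlatERL.sum_evalOn_pow_smul_add_two_eq_of_trace`);
* ★ `forall_root_value_eq_of_forall_char` — VALUE FORM: then for every `n` and every `z ∈ ℂ₂` with `(1+z)^{2ⁿ} = 1`,
  `ν(z) · P_{n,d_n}(w)(z) = μ(z) · θ_n(z)` (Birch `eval₂_mazurTateElement_eq_ratTwistedSymbolSum`, `CoreChi.tsum_coeff_pairingSum_mul_pow_eq_sum`,
  `CoreChi.exists_even_char_apply_cyclotomicGenerator_eq`);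
* ★ `exists_C_pow_mul_sub_eq_omega_mul_of_forall_root` — CONGRUENCE FORM: then for every `n`
  `∃ m q, C(2^m)·(ι(μ)·θ_n − ι(ν · P_{n,d_n}(w))) = ι(ω_n · q)` in `ℚ₂⟦T⟧` (`exists_C_pow_mul_sub_eq_omega_mul_of_forall_eval`);
* `charValue_of_levelIdentity` — the ADAPTER from FILE E2's per-character currency: from
  «`q.den · ∑_j ι(V j) χ(5)ʲ = u · q.num · R(χ) · RTSS f χ`» (`SSFlatERL.flat_level_identity_primitive/_trivial`) and a cusp multiplier `μ̃ ∈ Λ`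
  with `μ̃(χ(5)−1) = D·R(χ)` (K3 `KatoBK.cuspBrick_of_isNewformOf`), the displayed identity with `ν := C(D·q.den)`, `μ := C(u·q.num)·μ̃`.

So the F3 computation at `2` is reduced BY NAME to FILE E2's displayed per-level inputs (the (C6)-shaped pairing values, the orbit of logarithms
and their character sum `u·τ(ψ)` — FILE E0/E1 for THE Sprung–Honda system —, Kato's value law, the trivial-character values).

References: [Kobayashi2003] S. Kobayashi, Invent. Math. 152 (2003), (8.23), Prop. 8.25–8.26, proof of Thm. 6.3 (p. 25); [Kato2004Asterisque]
Thm. 12.5 (1); [Sprung2012] F. Sprung, J. Number Theory 132 (2012), Def. 3.1, Props. 6.3–6.5; [MazurTateTeitelbaum1986Invent] §I.10 (10.2), §I.13;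
[Pollack2003] Prop. 6.18; [Washington1997] Prop. 7.2, §7.2.
-/

set_option autoImplicit false
-- the Theorems namespace of this sub repeats the summit name by design (D-0017 nested layout)
set_option linter.dupNamespace false

noncomputable section

open scoped Classical MatrixGroups ModularForm NumberField

open CongruenceSubgroup WeierstrassCurve Field IsDedekindDomain NumberField Polynomial
  Literature.NumberTheory.GaloisRepresentations
  Literature.NumberTheory.EllipticCurves Literature.NumberTheory.EllipticCurves.ModularForms
  Literature.NumberTheory.EllipticCurves.Kobayashi2003 Literature.NumberTheory.EllipticCurves.Sprung2012
  ZpExtension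
  Summit.BirchSwinnertonDyer.BirchSwinnertonDyer.Theorems.SignedKatoOffTwo
  Summit.BirchSwinnertonDyer.BirchSwinnertonDyer.Theorems.SignedKatoOffTwo.CoreChi
  Summit.BirchSwinnertonDyer.BirchSwinnertonDyer.Theorems.SignedKatoOffTwo.KatoBK

namespace Summit.BirchSwinnertonDyer.BirchSwinnertonDyer.Theorems.SSFlatERL

universe u

variable {K : Type u} [Field K] (κ : ZpExtension K 2)
  {E : Type u} [Field E] [Algebra K E] (ι : AlgebraicClosure K →ₐ[K] AlgebraicClosure E)
  (W : WeierstrassCurve K) {N : ℕ} {f : CuspForm (Gamma0 N) 2}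

/-! ## §1 All even `2`-power-order characters, from the primitive ones (P-side = a functional on the Honda orbits) -/

/-- **All characters from the primitive ones, for the orbit values of a functional.** The hypothesis `hprim` is the per-character
identity at the PRIMITIVE even `2`-power-order characters modulo `2^{n+2}` and at the levels `n ≤ 1`; the P-side recursion comes from the
`a`-trace relation of the points `d` (`SSFlatERL.sum_evalOn_pow_smul_add_two_eq_of_trace`), the θ-side from
`SSFlatERL.eval₂_mazurTateElement_add_two_eq_of_cuspCoeff`; conclusion: the identity at EVERY even `2`-power-order `χ`.
[cite: Kobayashi2003, Thm. 6.3 (proof, p. 25)] [cite: Sprung2012, Props. 6.3–6.5] [cite: MazurTateTeitelbaum1986Invent, §I.10 Prop. (10.2)] -/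
theorem forall_char_of_evalOn_of_primitive_or_le_one [NeZero N] (hf0 : IsNewform0 f) (hQ : coeffField f = ⊥) (h2N : ¬ 2 ∣ N)
    {a : ℤ} (hap : cuspCoeff f 2 = (a : ℂ)) {g : Field.absoluteGaloisGroup E} (hg : κ.IsTopGenerator (resGalOfEmb ι g))
    {d : ℕ → localPoints W E} (hL : ∀ m, d m ∈ localLayerPointsOfEmb κ ι W m)
    (hTR : ∀ n, localTraceOfEmb κ ι W (n + 1) (n + 2) (d (n + 2)) = a • d (n + 1) - d n)
    (A : AddSubgroup (localPoints W E)) (hA : ∀ n j : ℕ, g ^ j • d n ∈ A) (w : A →+ ℤ_[2]) (μ ν : IwasawaAlgebra 2)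
    (hprim : ∀ (n : ℕ) (χ : DirichletCharacter ℂ_[2] (2 ^ (n + cyclotomicExponent 2))),
      χ.Even → (∃ j : ℕ, orderOf χ = 2 ^ j) → (χ.IsPrimitive ∨ n ≤ 1) →
      (∑' k, ((algebraMap ℚ_[2] ℂ_[2]).comp (algebraMap ℤ_[2] ℚ_[2])) (PowerSeries.coeff k ν) *
          (χ (cyclotomicGenerator 2 : ZMod (2 ^ (n + cyclotomicExponent 2))) - 1) ^ k) *
        (∑ j ∈ Finset.range (2 ^ n), ((algebraMap ℚ_[2] ℂ_[2]).comp (algebraMap ℤ_[2] ℚ_[2])) (evalOn W A w (g ^ j • d n)) *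
          χ (cyclotomicGenerator 2 : ZMod (2 ^ (n + cyclotomicExponent 2))) ^ j) =
      (∑' k, ((algebraMap ℚ_[2] ℂ_[2]).comp (algebraMap ℤ_[2] ℚ_[2])) (PowerSeries.coeff k μ) *
          (χ (cyclotomicGenerator 2 : ZMod (2 ^ (n + cyclotomicExponent 2))) - 1) ^ k) *
        ratTwistedSymbolSum f χ)
    (n : ℕ) (χ : DirichletCharacter ℂ_[2] (2 ^ (n + cyclotomicExponent 2))) (hev : χ.Even)
    (hord : ∃ j : ℕ, orderOf χ = 2 ^ j) :
    (∑' k, ((algebraMap ℚ_[2] ℂ_[2]).comp (algebraMap ℤ_[2] ℚ_[2])) (PowerSeries.coeff k ν) *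
        (χ (cyclotomicGenerator 2 : ZMod (2 ^ (n + cyclotomicExponent 2))) - 1) ^ k) *
      (∑ j ∈ Finset.range (2 ^ n), ((algebraMap ℚ_[2] ℂ_[2]).comp (algebraMap ℤ_[2] ℚ_[2])) (evalOn W A w (g ^ j • d n)) *
        χ (cyclotomicGenerator 2 : ZMod (2 ^ (n + cyclotomicExponent 2))) ^ j) =
    (∑' k, ((algebraMap ℚ_[2] ℂ_[2]).comp (algebraMap ℤ_[2] ℚ_[2])) (PowerSeries.coeff k μ) *
        (χ (cyclotomicGenerator 2 : ZMod (2 ^ (n + cyclotomicExponent 2))) - 1) ^ k) *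
      ratTwistedSymbolSum f χ :=
  forall_char_of_primitive_or_le_one hf0 hQ h2N hap μ ν (fun n j ↦ evalOn W A w (g ^ j • d n))
    (fun n _ hζ ↦ sum_evalOn_pow_smul_add_two_eq_of_trace κ ι W _ hg hL a n (hTR n) A (hA (n + 2)) (hA (n + 1)) (hA n) w hζ)
    hprim n χ hev hord

/-! ## §2 VALUE FORM at every `2ⁿ`-th root of unity -/

/-- **The value identity at every `z` with `(1+z)^{2ⁿ} = 1`**: if the per-character identity holds for every even `2`-power-order `χ`
modulo `2^{n+2}` (e.g. by `forall_char_of_evalOn_of_primitive_or_le_one`), then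
`ν(z) · P_{n,d_n}(w)(z) = μ(z) · θ_n(z)` — the character of `G_n` with `χ(5) = 1 + z` exists
(`CoreChi.exists_even_char_apply_cyclotomicGenerator_eq`), `P_{n,d_n}(w)(z) = ∑_j w(gʲ d_n)(1+z)ʲ` (`CoreChi.tsum_coeff_pairingSum_mul_pow_eq_sum`)
and `θ_n(z) = ratTwistedSymbolSum f χ` (Birch, `eval₂_mazurTateElement_eq_ratTwistedSymbolSum`). This is the VALUE shape t42's Z4 consumes.
[cite: MazurTateTeitelbaum1986Invent, §I.13] [cite: Pollack2003, Prop. 6.9 (proof)] [cite: Sprung2012, Def. 3.1 (p. 1489)] -/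
theorem forall_root_value_eq_of_forall_char (g : Field.absoluteGaloisGroup E) (d : ℕ → localPoints W E)
    (A : AddSubgroup (localPoints W E)) (w : A →+ ℤ_[2]) (μ ν : IwasawaAlgebra 2)
    (hall : ∀ (n : ℕ) (χ : DirichletCharacter ℂ_[2] (2 ^ (n + cyclotomicExponent 2))),
      χ.Even → (∃ j : ℕ, orderOf χ = 2 ^ j) →
      (∑' k, ((algebraMap ℚ_[2] ℂ_[2]).comp (algebraMap ℤ_[2] ℚ_[2])) (PowerSeries.coeff k ν) *
          (χ (cyclotomicGenerator 2 : ZMod (2 ^ (n + cyclotomicExponent 2))) - 1) ^ k) *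
        (∑ j ∈ Finset.range (2 ^ n), ((algebraMap ℚ_[2] ℂ_[2]).comp (algebraMap ℤ_[2] ℚ_[2])) (evalOn W A w (g ^ j • d n)) *
          χ (cyclotomicGenerator 2 : ZMod (2 ^ (n + cyclotomicExponent 2))) ^ j) =
      (∑' k, ((algebraMap ℚ_[2] ℂ_[2]).comp (algebraMap ℤ_[2] ℚ_[2])) (PowerSeries.coeff k μ) *
          (χ (cyclotomicGenerator 2 : ZMod (2 ^ (n + cyclotomicExponent 2))) - 1) ^ k) *
        ratTwistedSymbolSum f χ)
    (n : ℕ) (z : ℂ_[2]) (hz : (1 + z) ^ 2 ^ n = 1) :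
    (∑' k, ((algebraMap ℚ_[2] ℂ_[2]).comp (algebraMap ℤ_[2] ℚ_[2])) (PowerSeries.coeff k ν) * z ^ k) *
      (∑' k, ((algebraMap ℚ_[2] ℂ_[2]).comp (algebraMap ℤ_[2] ℚ_[2]))
          (PowerSeries.coeff k (pairingSum W A g n (d n) w)) * z ^ k) =
    (∑' k, ((algebraMap ℚ_[2] ℂ_[2]).comp (algebraMap ℤ_[2] ℚ_[2])) (PowerSeries.coeff k μ) * z ^ k) *
      (mazurTateElement f 2 n).eval₂ (algebraMap ℚ ℂ_[2]) z := by
  obtain ⟨χ, hev, hord, hχ⟩ := exists_even_char_apply_cyclotomicGenerator_eq n hz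
  have h := hall n χ hev hord
  have hB := eval₂_mazurTateElement_eq_ratTwistedSymbolSum f χ hev hord
  rw [hχ, add_sub_cancel_left] at h hB
  rw [← hB] at h
  have hP := tsum_coeff_pairingSum_mul_pow_eq_sum W A g n (d n) w (1 + z)
  rw [add_sub_cancel_left] at hP
  rw [hP]
  exact h

/-! ## §3 CONGRUENCE FORM: `C(2^m)·(ι μ · θ_n − ι(ν · P_{n,d_n}(w))) ∈ ι(ω_n Λ)` -/

/-- **The `Λ`-multiplier congruence** (the shape of `PlusMinusPAdicLFunction.IsCongrModOmega` with a multiplier, t42's Z2 hypothesis): if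
`ν(z)·P_{n,d_n}(w)(z) = μ(z)·θ_n(z)` for every `z` with `(1+z)^{2ⁿ} = 1` (e.g. by `forall_root_value_eq_of_forall_char`), then
`∃ m q, C(2^m)·(ι(μ)·θ_n − ι(ν · P_{n,d_n}(w))) = ι(ω_n · q)` in `ℚ₂⟦T⟧` (`exists_C_pow_mul_sub_eq_omega_mul_of_forall_eval`).
[cite: Pollack2003, Prop. 6.18 (proof)] [cite: Washington1997, Prop. 7.2] -/
theorem exists_C_pow_mul_sub_eq_omega_mul_of_forall_root (g : Field.absoluteGaloisGroup E) (d : ℕ → localPoints W E)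
    (A : AddSubgroup (localPoints W E)) (w : A →+ ℤ_[2]) (μ ν : IwasawaAlgebra 2) (n : ℕ)
    (hval : ∀ z : ℂ_[2], (1 + z) ^ 2 ^ n = 1 →
      (∑' k, ((algebraMap ℚ_[2] ℂ_[2]).comp (algebraMap ℤ_[2] ℚ_[2])) (PowerSeries.coeff k ν) * z ^ k) *
        (∑' k, ((algebraMap ℚ_[2] ℂ_[2]).comp (algebraMap ℤ_[2] ℚ_[2]))
            (PowerSeries.coeff k (pairingSum W A g n (d n) w)) * z ^ k) =
      (∑' k, ((algebraMap ℚ_[2] ℂ_[2]).comp (algebraMap ℤ_[2] ℚ_[2])) (PowerSeries.coeff k μ) * z ^ k) *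
        (mazurTateElement f 2 n).eval₂ (algebraMap ℚ ℂ_[2]) z) :
    ∃ (m : ℕ) (q : IwasawaAlgebra 2),
      PowerSeries.C ((2 : ℚ_[2]) ^ m) *
          (iwasawaToPowerSeries 2 μ * (((mazurTateElement f 2 n).map (algebraMap ℚ ℚ_[2]) : ℚ_[2][X]) : PowerSeries ℚ_[2]) -
            iwasawaToPowerSeries 2 (ν * pairingSum W A g n (d n) w)) =
        iwasawaToPowerSeries 2 (((cyclotomicOmega 2 n).map (Int.castRingHom ℤ_[2]) : PowerSeries ℤ_[2]) * q) := by
  set ιZ : ℤ_[2] →+* ℂ_[2] := (algebraMap ℚ_[2] ℂ_[2]).comp (algebraMap ℤ_[2] ℚ_[2]) with hιZ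
  have hmain := exists_C_pow_mul_sub_eq_omega_mul_of_forall_eval (p := 2) (n := n) μ (ν * pairingSum W A g n (d n) w)
    ((mazurTateElement f 2 n).map (algebraMap ℚ ℚ_[2])) ?_
  · simpa only [Nat.cast_ofNat] using hmain
  intro z hz
  have hz1 : ‖z‖ < 1 := norm_lt_one_of_one_add_pow_eq_one hz
  rw [tsum_map_coeff_mul_mul_pow ιZ (norm_algebraMap_coeff_le_one _) (norm_algebraMap_coeff_le_one _) hz1, Polynomial.eval₂_map,
    RingHom.ext_rat ((algebraMap ℚ_[2] ℂ_[2]).comp (algebraMap ℚ ℚ_[2])) (algebraMap ℚ ℂ_[2])]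
  exact (hval z hz).symm

/-! ## §4 The adapter from FILE E2's per-character currency -/

/-- **From the `(q, u, R(χ))`-currency of `SSFlatERL.flat_level_identity_primitive/_trivial` to the displayed `(μ, ν)`-identity.** At one
level `n` and one even `2`-power-order `χ` modulo `2^{n+2}`: from `q.den · ∑_j ι(V j) χ(5)ʲ = u · q.num · R · RTSS f χ` (E2's conclusion,
`R = R(χ)` the four-term cusp factor) and a cusp multiplier `μ̃ ∈ Λ` with `μ̃(χ(5) − 1) = D · R` (K3 `KatoBK.cuspBrick_of_isNewformOf`), the
identity `ν(χ(5)−1) · ∑_j ι(V j) χ(5)ʲ = μ(χ(5)−1) · RTSS f χ` with `ν := C(D·q.den)` and `μ := C(u·q.num)·μ̃`.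
[cite: Kato2004Asterisque, Thm. 12.5 (1)] [cite: Kobayashi2003, Prop. 8.25–8.26] -/
theorem charValue_of_levelIdentity (n : ℕ) (χ : DirichletCharacter ℂ_[2] (2 ^ (n + 2))) (hord : ∃ j : ℕ, orderOf χ = 2 ^ j)
    (V : ℕ → ℤ_[2]) (q : ℚ) (u D : ℤ) (R RTSS : ℂ_[2]) (μt : IwasawaAlgebra 2)
    (hE2 : (q.den : ℂ_[2]) * ∑ j ∈ Finset.range (2 ^ n),
        algebraMap (PadicAlgCl 2) ℂ_[2] (algebraMap ℚ_[2] (PadicAlgCl 2) (V j : ℚ_[2])) * χ (5 : ZMod (2 ^ (n + 2))) ^ j =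
      ((u : ℚ) : ℂ_[2]) * (q.num : ℂ_[2]) * R * RTSS)
    (hμt : HasSum (fun k ↦ ((algebraMap ℚ_[2] ℂ_[2]).comp (algebraMap ℤ_[2] ℚ_[2])) (PowerSeries.coeff k μt) *
        (χ (5 : ZMod (2 ^ (n + 2))) - 1) ^ k) ((D : ℂ_[2]) * R)) :
    (∑' k, ((algebraMap ℚ_[2] ℂ_[2]).comp (algebraMap ℤ_[2] ℚ_[2]))
          (PowerSeries.coeff k (PowerSeries.C (((D * q.den : ℤ) : ℤ_[2])))) * (χ (5 : ZMod (2 ^ (n + 2))) - 1) ^ k) *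
      (∑ j ∈ Finset.range (2 ^ n), ((algebraMap ℚ_[2] ℂ_[2]).comp (algebraMap ℤ_[2] ℚ_[2])) (V j) *
        χ (5 : ZMod (2 ^ (n + 2))) ^ j) =
    (∑' k, ((algebraMap ℚ_[2] ℂ_[2]).comp (algebraMap ℤ_[2] ℚ_[2]))
          (PowerSeries.coeff k (PowerSeries.C (((u * q.num : ℤ) : ℤ_[2])) * μt)) * (χ (5 : ZMod (2 ^ (n + 2))) - 1) ^ k) *
      RTSS := by
  have hcg5 : cyclotomicGenerator 2 = 5 := rfl
  have hz : ‖χ (5 : ZMod (2 ^ (n + 2))) - 1‖ < 1 := by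
    have h := Literature.NumberTheory.EllipticCurves.norm_apply_cyclotomicGenerator_sub_one_lt χ hord
    simpa only [hcg5, Nat.cast_ofNat] using h
  have hν := hasSum_cpCoeff_C (((D * q.den : ℤ) : ℤ_[2])) (χ (5 : ZMod (2 ^ (n + 2))) - 1)
  have hμ := hasSum_cpCoeff_mul hz (hasSum_cpCoeff_C (((u * q.num : ℤ) : ℤ_[2])) (χ (5 : ZMod (2 ^ (n + 2))) - 1)) hμt
  rw [hν.tsum_eq, hμ.tsum_eq]
  have hsum : ∑ j ∈ Finset.range (2 ^ n), ((algebraMap ℚ_[2] ℂ_[2]).comp (algebraMap ℤ_[2] ℚ_[2])) (V j) *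
          χ (5 : ZMod (2 ^ (n + 2))) ^ j =
      ∑ j ∈ Finset.range (2 ^ n),
        algebraMap (PadicAlgCl 2) ℂ_[2] (algebraMap ℚ_[2] (PadicAlgCl 2) (V j : ℚ_[2])) * χ (5 : ZMod (2 ^ (n + 2))) ^ j := by
    refine Finset.sum_congr rfl fun j _ ↦ ?_
    rw [RingHom.comp_apply, IsScalarTower.algebraMap_apply ℚ_[2] (PadicAlgCl 2) ℂ_[2]]
    rfl
  rw [hsum, map_intCast, map_intCast]
  simp only [Int.cast_mul, Int.cast_natCast, Rat.cast_intCast] at hE2 ⊢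
  linear_combination (D : ℂ_[2]) * hE2

end Summit.BirchSwinnertonDyer.BirchSwinnertonDyer.Theorems.SSFlatERL

end
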